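import Summits.BirchSwinnertonDyer.BirchSwinnertonDyer.Theorems.PrintCFramBottomClassIndexLawFiveLeHeegnerTwistShaSupply
import Summits.BirchSwinnertonDyer.BirchSwinnertonDyer.Theorems.PrintCFramBottomClassIndexLawFiveLeHeegnerTwistShaOfUnit
import Summits.BirchSwinnertonDyer.BirchSwinnertonDyer.Theorems.PrintCFramBottomClassIndexLawFiveLeKrizLiLocusCharacterData
import Summits.BirchSwinnertonDyer.BirchSwinnertonDyer.Theorems.PrintCFramBottomClassIndexLawFiveLeOffLocusResidue
import Summits.BirchSwinnertonDyer.BirchSwinnertonDyer.Theorems.PrintCFramBottomClassIndexLawFiveLeHeegnerFieldSupplySocket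
import Literature.NumberTheory.EllipticCurves.BurungaleSkinnerTianWan2024.CyclotomicPConverseOverQProofs
import HarnessLib

/-!
# Crux `PrintCFram.BottomClassIndexLawFiveLe` (stmt-BirchSwinnertonDyer-20372), line `eisenstein-resource-bdp-line` (registry v19/v20):
# **STUB C ⟺ C_Ш♭ MODULO PRINT** — granting `ToricPublishedInputs`, Kriz–Li Thm 1.20, Mazur–Wiles Thm 2 and Cassels–Tate, the analytic stub C
# («an admissible Heegner field with unit `K''`-factor») and the Ш-currency supply C_Ш♭ («an admissible Heegner twist pair with `Ш[p] = 0`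
# and `L ≠ 0`») are the same statement; and w8 g4's curve-free (P) supplies both
# (cell `bsd-print-cfram`, width seat `bsd-line-cfram-p1-w5` g4; THEOREMS ONLY, `--supports` 20372; BSD is not proved by any of this)

HONEST FRAMING. Nothing about BSD is proved here and no stub is closed. This file closes the circle opened by `…HeegnerTwistShaSupply` (C ⟸ C_Ш,
MW + GZK) and `…HeegnerTwistShaOfUnit` (unit field factor ⟹ `Ш[p]`-trivial twist pair, CT + GZK): under the line's standing print facts the
converse C ⟹ C_Ш♭ holds too, because Kriz–Li Thm. 1.20 at C's field makes the Heegner point non-torsion, hence `L(W^{(d)},1) ≠ 0` (Gross–Zagier),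
the one clause of C_Ш♭ that C does not state.

* §1 **`shaSupplyBinders_of_stubC`** — `ToricPublishedInputs` ∧ KL Thm 1.20 ∧ Cassels–Tate ⊢ C ⟹ C_Ш♭: C's `K''` yields character data
  (`OffLocusResidue.exists_characterData_of_unit_classFactor_of_unit_fieldFactor`), hence a Kriz–Li datum with `L(W^{(d)},1) ≠ 0`
  (`KrizLiLValueFree.exists_krizLiDatum_of_characterData`); rigidity of (4) (`OffLocusDictionary.bernoulliPair_eq_of_hss`) and `p`-integrality of
  the class factor (`BernoulliUnits.norm_bernoulliPair_le_one_of_hss`) give a unit field factor there; a globally minimal twist model exists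
  (`BurungaleSkinnerTianWan2024.exists_isGloballyMinimal_twist_models`); `HeegnerTwistSha.twist_noPTorsion_pair_of_unit_fieldFactor` finishes.
  **`stubC_iff_shaSupplyBinders`** — C ⟺ C_Ш♭ (⟸ `HeegnerTwistSha.stubC_of_heegnerTwistShaSupply_binders`, MW + GZK).
* §2 `shaSupplyBinders_of_bernoulliSupply` — w8 g4's curve-free (P) (hypothesis of `HeegnerFieldSupply.stubC_of_splitPrimes_bernoulliUnit`, p676235)
  ⟹ C_Ш♭ (through §1).

CONDITIONAL by construction (audit: `proof.conditional`); credits nothing. beyond-print theorem: NO. BSD is not proved by any of this; no summit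
statement is proved by this seat. References: [KrizLi2019] Thm. 1.20 (pp. 7–8), Rem. 1.21, §8; [GrossZagier1986] I.(6.3); [MazurWiles1984] Thm. 2;
[Cassels1962ArithmeticIV]; [Washington1997] Thm. 5.11, Cor. 5.13; LEAD g12 STATUS 2026-08-29T00:00:49Z (registry v20).
-/

set_option autoImplicit false
-- `…BirchSwinnertonDyer.BirchSwinnertonDyer.Theorems…` is the problem's mandated namespace (D-0017).
set_option linter.dupNamespace false

noncomputable section

open scoped Classical

namespace Summit.BirchSwinnertonDyer.BirchSwinnertonDyer.Theorems.PrintCFram.HeegnerTwistSha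

open WeierstrassCurve NumberField IsDedekindDomain DirichletCharacter Literature.NumberTheory.LFunctions
  Literature.NumberTheory.EllipticCurves
  Literature.NumberTheory.EllipticCurves.Rank1Residual
  Literature.NumberTheory.EllipticCurves.KrizLi2019
  Literature.NumberTheory.NumberFields
  Summit.BirchSwinnertonDyer.Rank1Residual
  Summit.BirchSwinnertonDyer.BirchSwinnertonDyer.Theorems.PrintCFram

/-! ## §1 Under the line's print facts and Kriz–Li Thm 1.20, Stub C and C_Ш♭ are EQUIVALENT -/

/-- **C ⟹ C_Ш♭ (granting `ToricPublishedInputs`, Kriz–Li Thm. 1.20 and Cassels–Tate).** If registry v19's Stub C holds, then every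
regular rank-one class member `W` (CM, minimal, `CMRamified W p`, `p ≥ 5`, `r_an = 1`, odd datum `(f, ψ, ω)` + `hss`, UNIT class factor)
has an admissible Heegner `K''` with `L(W^{(d)},1) ≠ 0` and a globally minimal model `Wd` of the twist whose rational `p`-isogeny pair is
`Ш[p]`-trivial. Route: C's `K''` has a unit field factor, so CHARACTER DATA exist (`OffLocusResidue.exists_characterData_of_unit_classFactor_
of_unit_fieldFactor`), hence a full Kriz–Li datum at some admissible `K₂` with `L(W^{(d_{K₂})},1) ≠ 0` (`KrizLiLValueFree.exists_krizLiDatum_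
of_characterData`: Kriz–Li's unit logarithm ⟹ Heegner point non-torsion ⟹ Gross–Zagier); (4) at `K₂` is rigid (`OffLocusDictionary.
bernoulliPair_eq_of_hss`) and its class factor is `p`-integral, so the field factor at `K₂` for `ψ` is a unit; a minimal model of the twist
exists (`exists_isGloballyMinimal_twist_models`) and §1's ⟹ (`twist_noPTorsion_pair_of_unit_fieldFactor`) finishes. CONDITIONAL; closes no stub.
[cite: KrizLi2019, Thm. 1.20 (pp. 7–8), Rem. 1.21 and §8] [cite: GrossZagier1986, Thm. I.(6.3)] [cite: Cassels1962ArithmeticIV] -/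
theorem shaSupplyBinders_of_stubC
    (hKL : thm120_padicLogHeegner_unit_of_bernoulli)
    (hF : Summit.BirchSwinnertonDyer.BirchSwinnertonDyer.Theses.UniversalToricDescent.ToricPublishedInputs)
    (hCT : exists_casselsTate_pairing (K := ℚ))
    (hC :
    ∀ (W : WeierstrassCurve ℚ) [W.IsElliptic] [W.IsGloballyMinimal] (p : ℕ) [Fact p.Prime],
      W.HasCM → CMRamified W p → 5 ≤ p → W.analyticRank = 1 →
      ∀ (f : ℕ) [NeZero f] (ψ : DirichletCharacter ℚ_[p] f) (ω : DirichletCharacter ℚ_[p] p),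
        ψ.Odd → IsTeichmullerCharacter ω →
        (∀ ℓ : ℕ, ℓ.Prime → ¬ (ℓ ∣ p * W.conductorNorm ℤ) →
          ‖((W.LFunction ℓ : ℤ) : ℚ_[p]) - (ψ (ℓ : ZMod f) + ψ⁻¹ (ℓ : ZMod f) * ω (ℓ : ZMod p))‖ < 1) →
        ¬ ‖bernoulliOnePrim ψ⁻¹‖ ≤ (p : ℝ)⁻¹ →
        ∃ (K : Type) (_ : Field K) (_ : NumberField K) (εK : DirichletCharacter ℚ_[p] (NumberField.discr K).natAbs),
          IsImaginaryQuadratic K ∧ SatisfiesHeegnerHypothesis (W.conductorNorm ℤ) K ∧ Odd (NumberField.discr K) ∧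
          NumberField.discr K < -4 ∧ IsKroneckerCharacterOf K εK ∧
          ¬ ‖bernoulliOnePrim (bernoulliCharTwo ψ εK ω)‖ ≤ (p : ℝ)⁻¹) :
    ∀ (W : WeierstrassCurve ℚ) [W.IsElliptic] [W.IsGloballyMinimal] (p : ℕ) [Fact p.Prime],
      W.HasCM → CMRamified W p → 5 ≤ p → W.analyticRank = 1 →
      ∀ (f : ℕ) [NeZero f] (ψ : DirichletCharacter ℚ_[p] f) (ω : DirichletCharacter ℚ_[p] p), ψ.Odd →
      IsTeichmullerCharacter ω →
      (∀ ℓ : ℕ, ℓ.Prime → ¬ (ℓ ∣ p * W.conductorNorm ℤ) →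
        ‖((W.LFunction ℓ : ℤ) : ℚ_[p]) - (ψ (ℓ : ZMod f) + ψ⁻¹ (ℓ : ZMod f) * ω (ℓ : ZMod p))‖ < 1) →
      ¬ ‖bernoulliOnePrim ψ⁻¹‖ ≤ (p : ℝ)⁻¹ →
      ∃ (K : Type) (_ : Field K) (_ : NumberField K), IsImaginaryQuadratic K ∧
        SatisfiesHeegnerHypothesis (W.conductorNorm ℤ) K ∧ Odd (NumberField.discr K) ∧ NumberField.discr K < -4 ∧
        (W.quadraticTwist (NumberField.discr K : ℚ)).entireLFunction 1 ≠ 0 ∧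
        ∃ (Wd : WeierstrassCurve ℚ) (_ : Wd.IsElliptic) (_ : Wd.IsGloballyMinimal),
          (∃ C : VariableChange ℚ, C • W.quadraticTwist (NumberField.discr K : ℚ) = Wd) ∧
          (∀ c ∈ Wd.sha, p • c = 0 → c = 0) ∧
          (∀ (W₁ : WeierstrassCurve ℚ) [W₁.IsElliptic] [W₁.IsGloballyMinimal], W₁.HasCM → CMRamified W₁ p →
            (∃ φ : Isogeny Wd W₁, φ.degree = p) → ∀ c ∈ W₁.sha, p • c = 0 → c = 0) := by
  intro W _ _ p _ hCM hram h5 hr f _ ψ ω hψ hω hss hcls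
  have hpp : p.Prime := Fact.out
  obtain ⟨-, -, hGZK, -⟩ := id hF
  obtain ⟨K, _, _, εK, hK, hH, hodd, hd4, hεK, hfld⟩ := hC W p hCM hram h5 hr f ψ ω hψ hω hss hcls
  obtain ⟨K₁, _, _, f₁, _, ψ₁, ω₁, εK₁, hK₁, hH₁, hodd₁, hd4₁, hψ₁, hω₁, hss₁, h1, h1', h3, hεK₁, h4₁⟩ :=
    OffLocusResidue.exists_characterData_of_unit_classFactor_of_unit_fieldFactor W p hCM hram h5 ψ ω hψ hω hss hcls K hK hH hodd hd4
      εK hεK hfld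
  obtain ⟨N, _, K₂, iK₂, iK₂', Dt, H, ι, P, f₂, _, ψ₂, ω₂, εK₂, hN, hK₂, hH₂, hodd₂, hd4₂, hLt₂, hP, hψ₂, hω₂, hss₂, h1₂, h1₂', h3₂, hεK₂, h4₂⟩ :=
    KrizLiLValueFree.exists_krizLiDatum_of_characterData hKL hF W hCM hram h5 hr K₁ hK₁ hH₁ hodd₁ hd4₁ f₁ ψ₁ ω₁ hψ₁ hω₁ hss₁ h1 h1' h3
      εK₁ hεK₁ h4₁
  have hH₂' : SatisfiesHeegnerHypothesis (W.conductorNorm ℤ) K₂ := by rw [hN]; exact hH₂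
  -- (4) at `K₂` moved to the odd datum `ψ` (rigidity), then split: the class factor is `p`-integral, so the field factor is a unit
  have h4 : ¬ ‖bernoulliOnePrim (bernoulliCharOne ψ εK₂) * bernoulliOnePrim (bernoulliCharTwo ψ εK₂ ω)‖ ≤ (p : ℝ)⁻¹ := by
    rw [← OffLocusDictionary.bernoulliPair_eq_of_hss W h5 K₂ ψ ψ₂ ω ω₂ εK₂ εK₂ hω hω₂ hss hss₂ hεK₂ hεK₂]
    exact h4₂
  haveI : NeZero (NumberField.discr K₂).natAbs := ⟨Int.natAbs_ne_zero.mpr (NumberField.discr_ne_zero K₂)⟩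
  have hpd : ¬ p ∣ (NumberField.discr K₂).natAbs := by
    rw [← Int.natCast_dvd]
    exact Literature.SatisfiesHeegnerHypothesis.not_dvd_discr hK₂.1 hH₂' hpp (BorelTorsion.dvd_conductorNorm_of_cmRamified W p hCM hram)
  obtain ⟨ha, -⟩ := BernoulliUnits.norm_bernoulliPair_le_one_of_hss W hCM hram h5 hω ψ hss εK₂ hpd
  have hfld₂ : ¬ ‖bernoulliOnePrim (bernoulliCharTwo ψ εK₂ ω)‖ ≤ (p : ℝ)⁻¹ := by
    intro hb
    apply h4
    rw [norm_mul]
    calc ‖bernoulliOnePrim (bernoulliCharOne ψ εK₂)‖ * ‖bernoulliOnePrim (bernoulliCharTwo ψ εK₂ ω)‖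
        ≤ 1 * (p : ℝ)⁻¹ := mul_le_mul ha hb (norm_nonneg _) zero_le_one
      _ = (p : ℝ)⁻¹ := one_mul _
  -- a globally minimal model of the twist, and the converse half
  obtain ⟨Wd, iWd, iWd', C, C₀, m, hCWd, -⟩ := BurungaleSkinnerTianWan2024.exists_isGloballyMinimal_twist_models W hK₂.1
  have hC' : ∃ C' : VariableChange ℚ, C' • W.quadraticTwist (NumberField.discr K₂ : ℚ) = Wd :=
    ⟨C⁻¹, by rw [← hCWd, inv_smul_smul]⟩
  obtain ⟨hsha, hsha₁⟩ := twist_noPTorsion_pair_of_unit_fieldFactor hCT hGZK W hCM hram h5 ψ ω hψ hω hss K₂ hK₂ εK₂ hεK₂ hfld₂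
    Wd hC' hLt₂
  exact ⟨K₂, iK₂, iK₂', hK₂, hH₂', hodd₂, hd4₂, hLt₂, Wd, iWd, iWd', hC', hsha, hsha₁⟩

/-- **STUB C ⟺ C_Ш♭** (granting `ToricPublishedInputs`, Kriz–Li Thm. 1.20, Mazur–Wiles Thm. 2 and Cassels–Tate): registry v19's ANALYTIC
residue C is EQUIVALENT to the Ш-currency supply statement C_Ш♭ «every regular rank-one class member has an admissible Heegner `K''`
with `L(W^{(d)},1) ≠ 0` and a globally minimal twist model whose rational `p`-isogeny pair is `Ш[p]`-trivial» (⟸ this seat's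
`HeegnerTwistSha.stubC_of_heegnerTwistShaSupply_binders`, MW + GZK; ⟹ `shaSupplyBinders_of_stubC`). So on this line «C is analytic» and
«C is a horizontal `Ш[p] = 0` statement for the twist family» are the same assertion modulo print. CONDITIONAL; closes no stub; BSD is
not proved by any of this. [cite: KrizLi2019, Thm. 1.20 (pp. 7–8) and §8] [cite: MazurWiles1984, Thm. 2 (p. 216)] [cite: Cassels1962ArithmeticIV] -/
theorem stubC_iff_shaSupplyBinders
    (hKL : thm120_padicLogHeegner_unit_of_bernoulli)
    (hF : Summit.BirchSwinnertonDyer.BirchSwinnertonDyer.Theses.UniversalToricDescent.ToricPublishedInputs)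
    (hMW : MazurWiles1984.thm2_card_oddChiClassGroup_eq_bernoulli) (hCT : exists_casselsTate_pairing (K := ℚ)) :
    (∀ (W : WeierstrassCurve ℚ) [W.IsElliptic] [W.IsGloballyMinimal] (p : ℕ) [Fact p.Prime],
      W.HasCM → CMRamified W p → 5 ≤ p → W.analyticRank = 1 →
      ∀ (f : ℕ) [NeZero f] (ψ : DirichletCharacter ℚ_[p] f) (ω : DirichletCharacter ℚ_[p] p),
        ψ.Odd → IsTeichmullerCharacter ω →
        (∀ ℓ : ℕ, ℓ.Prime → ¬ (ℓ ∣ p * W.conductorNorm ℤ) →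
          ‖((W.LFunction ℓ : ℤ) : ℚ_[p]) - (ψ (ℓ : ZMod f) + ψ⁻¹ (ℓ : ZMod f) * ω (ℓ : ZMod p))‖ < 1) →
        ¬ ‖bernoulliOnePrim ψ⁻¹‖ ≤ (p : ℝ)⁻¹ →
        ∃ (K : Type) (_ : Field K) (_ : NumberField K) (εK : DirichletCharacter ℚ_[p] (NumberField.discr K).natAbs),
          IsImaginaryQuadratic K ∧ SatisfiesHeegnerHypothesis (W.conductorNorm ℤ) K ∧ Odd (NumberField.discr K) ∧
          NumberField.discr K < -4 ∧ IsKroneckerCharacterOf K εK ∧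
          ¬ ‖bernoulliOnePrim (bernoulliCharTwo ψ εK ω)‖ ≤ (p : ℝ)⁻¹) ↔
    (∀ (W : WeierstrassCurve ℚ) [W.IsElliptic] [W.IsGloballyMinimal] (p : ℕ) [Fact p.Prime],
      W.HasCM → CMRamified W p → 5 ≤ p → W.analyticRank = 1 →
      ∀ (f : ℕ) [NeZero f] (ψ : DirichletCharacter ℚ_[p] f) (ω : DirichletCharacter ℚ_[p] p), ψ.Odd →
      IsTeichmullerCharacter ω →
      (∀ ℓ : ℕ, ℓ.Prime → ¬ (ℓ ∣ p * W.conductorNorm ℤ) →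
        ‖((W.LFunction ℓ : ℤ) : ℚ_[p]) - (ψ (ℓ : ZMod f) + ψ⁻¹ (ℓ : ZMod f) * ω (ℓ : ZMod p))‖ < 1) →
      ¬ ‖bernoulliOnePrim ψ⁻¹‖ ≤ (p : ℝ)⁻¹ →
      ∃ (K : Type) (_ : Field K) (_ : NumberField K), IsImaginaryQuadratic K ∧
        SatisfiesHeegnerHypothesis (W.conductorNorm ℤ) K ∧ Odd (NumberField.discr K) ∧ NumberField.discr K < -4 ∧
        (W.quadraticTwist (NumberField.discr K : ℚ)).entireLFunction 1 ≠ 0 ∧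
        ∃ (Wd : WeierstrassCurve ℚ) (_ : Wd.IsElliptic) (_ : Wd.IsGloballyMinimal),
          (∃ C : VariableChange ℚ, C • W.quadraticTwist (NumberField.discr K : ℚ) = Wd) ∧
          (∀ c ∈ Wd.sha, p • c = 0 → c = 0) ∧
          (∀ (W₁ : WeierstrassCurve ℚ) [W₁.IsElliptic] [W₁.IsGloballyMinimal], W₁.HasCM → CMRamified W₁ p →
            (∃ φ : Isogeny Wd W₁, φ.degree = p) → ∀ c ∈ W₁.sha, p • c = 0 → c = 0)) := by
  obtain ⟨-, -, hGZK, -⟩ := id hF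
  exact ⟨shaSupplyBinders_of_stubC hKL hF hCT, stubC_of_heegnerTwistShaSupply_binders hMW hGZK⟩

/-! ## §2 w8 g4's curve-free (P) supplies C_Ш♭ -/

/-- **(P) ⟹ C_Ш♭ (granting `ToricPublishedInputs`, Kriz–Li Thm. 1.20 and Cassels–Tate).** w8 g4's CURVE-FREE supply statement (P)
(generalized Bernoulli numbers of quadratic characters with a splitting condition; the hypothesis of
`HeegnerFieldSupply.stubC_of_splitPrimes_bernoulliUnit`, p676235, = LEAD g12's registry-v20 `stub_bernoulliSupply`) gives Stub C, hence (§1)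
the Ш-currency supply C_Ш♭: every regular rank-one class member has an admissible Heegner twist pair with trivial `Ш[p]` and `L ≠ 0`.
CONDITIONAL; closes no stub. [cite: KrizLi2019, Thm. 1.20 (pp. 7–8) and §8] [cite: Washington1997, Thm. 5.11 and Cor. 5.13] [cite: Cassels1962ArithmeticIV] -/
theorem shaSupplyBinders_of_bernoulliSupply
    (hKL : thm120_padicLogHeegner_unit_of_bernoulli)
    (hF : Summit.BirchSwinnertonDyer.BirchSwinnertonDyer.Theses.UniversalToricDescent.ToricPublishedInputs)
    (hCT : exists_casselsTate_pairing (K := ℚ))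
    (hP : ∀ (p : ℕ) [Fact p.Prime] (m : ℕ) [NeZero m] (χ : DirichletCharacter ℚ_[p] m) (k : ℕ),
      5 ≤ p → m.Coprime p → χ.IsPrimitive → χ.IsQuadratic → (k = (p + 1) / 4 ∨ k = (3 * p - 1) / 4) →
      2 ≤ k → k ≤ p - 2 → χ (-1) * (-1) ^ k = -1 →
      ¬ ‖((p - k : ℕ) : ℚ_[p])⁻¹ * generalizedBernoulli (p - k) χ‖ ≤ (p : ℝ)⁻¹ →
      ∃ (K : Type) (_ : Field K) (_ : NumberField K) (εK : DirichletCharacter ℚ_[p] (NumberField.discr K).natAbs),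
        IsImaginaryQuadratic K ∧
        (∀ q : ℕ, q.Prime → q ∣ p * m → ((Ideal.span {(q : ℤ)}).primesOver (𝓞 K)).ncard = 2) ∧
        Odd (NumberField.discr K) ∧ NumberField.discr K < -4 ∧ IsKroneckerCharacterOf K εK ∧
        ¬ ‖(k : ℚ_[p])⁻¹ * @generalizedBernoulli ℚ_[p] _ _
            (changeLevel (dvd_mul_right m (NumberField.discr K).natAbs) χ *
              changeLevel (dvd_mul_left (NumberField.discr K).natAbs m) εK).conductor ⟨conductor_ne_zero _⟩ k
            (changeLevel (dvd_mul_right m (NumberField.discr K).natAbs) χ *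
              changeLevel (dvd_mul_left (NumberField.discr K).natAbs m) εK).primitiveCharacter‖ ≤ (p : ℝ)⁻¹) :
    ∀ (W : WeierstrassCurve ℚ) [W.IsElliptic] [W.IsGloballyMinimal] (p : ℕ) [Fact p.Prime],
      W.HasCM → CMRamified W p → 5 ≤ p → W.analyticRank = 1 →
      ∀ (f : ℕ) [NeZero f] (ψ : DirichletCharacter ℚ_[p] f) (ω : DirichletCharacter ℚ_[p] p), ψ.Odd →
      IsTeichmullerCharacter ω →
      (∀ ℓ : ℕ, ℓ.Prime → ¬ (ℓ ∣ p * W.conductorNorm ℤ) →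
        ‖((W.LFunction ℓ : ℤ) : ℚ_[p]) - (ψ (ℓ : ZMod f) + ψ⁻¹ (ℓ : ZMod f) * ω (ℓ : ZMod p))‖ < 1) →
      ¬ ‖bernoulliOnePrim ψ⁻¹‖ ≤ (p : ℝ)⁻¹ →
      ∃ (K : Type) (_ : Field K) (_ : NumberField K), IsImaginaryQuadratic K ∧
        SatisfiesHeegnerHypothesis (W.conductorNorm ℤ) K ∧ Odd (NumberField.discr K) ∧ NumberField.discr K < -4 ∧
        (W.quadraticTwist (NumberField.discr K : ℚ)).entireLFunction 1 ≠ 0 ∧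
        ∃ (Wd : WeierstrassCurve ℚ) (_ : Wd.IsElliptic) (_ : Wd.IsGloballyMinimal),
          (∃ C : VariableChange ℚ, C • W.quadraticTwist (NumberField.discr K : ℚ) = Wd) ∧
          (∀ c ∈ Wd.sha, p • c = 0 → c = 0) ∧
          (∀ (W₁ : WeierstrassCurve ℚ) [W₁.IsElliptic] [W₁.IsGloballyMinimal], W₁.HasCM → CMRamified W₁ p →
            (∃ φ : Isogeny Wd W₁, φ.degree = p) → ∀ c ∈ W₁.sha, p • c = 0 → c = 0) :=
  shaSupplyBinders_of_stubC hKL hF hCT (HeegnerFieldSupply.stubC_of_splitPrimes_bernoulliUnit hP)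

end Summit.BirchSwinnertonDyer.BirchSwinnertonDyer.Theorems.PrintCFram.HeegnerTwistSha

end
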